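import Summits.ResolutionOfSingularities.ResolutionOfSingularities.Theses.IndSmooth
import Literature.AlgebraicGeometry.Resolution.SmoothImpliesRegular
import Mathlib.RingTheory.Smooth.Locus
import HarnessLib

/-!
# Localizing a smooth chart at the centre: `stub_localChart`
# (stmt-ResolutionOfSingularities-16088, line `birth`, skeleton v5)

Route `ResolutionOfSingularities/IndSmooth`, crux #3 `SmoothToUniformizing`. Skeleton v5 of the line
`birth` works with LOCAL REGULAR CHARTS of a `k`-subalgebra `R` of a valued field `(K, O)`: a
regular local `k`-algebra `L`, essentially of finite type, with `k`-algebra maps `ψ : R → L`,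
`χ : L → K` such that `χ(L) ⊆ O`, `χ⁻¹(𝔪_O) = 𝔪_L` and `χ ∘ ψ =` the inclusion `R ⊆ K`.

This file proves the registered stub `stub_localChart`: a SMOOTH chart `R → T → O` (a smooth
`k`-algebra `T` with `ψ : R → T`, `χ : T → K`, `χ(T) ⊆ O`, `χ ∘ ψ =` inclusion) localizes to a
local regular chart. Construction:

* the **centre** `𝔮 := χ⁻¹(𝔪_O) = {t | v_O(χ t) < 1}` is a prime of `T` (the preimage of `𝔪_O`
  under the cod-restriction `T → O` of `χ`);
* `L := T_𝔮` is a regular local ring: `T` is smooth over the field `k`, hence smooth at `𝔮`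
  (`Algebra.smoothLocus_eq_univ`), hence `T_𝔮` is regular (EGA IV 17.5.8 (iii) / Görtz–Wedhorn,
  Lemma 6.26; the tree's `isRegularLocalRing_of_isSmoothAt`); it is essentially of finite type
  over `k` as a localization of a finitely presented algebra (Mathlib instances);
* off `𝔮` the chart takes values of valuation `1`, in particular units of `K`, so `χ` extends to
  `χ' : T_𝔮 → K` (`IsLocalization.liftAlgHom`) with `v_O(χ'(t/s)) = v_O(χ t)`; hence
  `χ'(T_𝔮) ⊆ O` and `χ'⁻¹(𝔪_O) = 𝔮 T_𝔮 = 𝔪_{T_𝔮}`;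
* `ψ' := (T → T_𝔮) ∘ ψ`, and `χ' ∘ ψ' = χ ∘ ψ =` the inclusion.

The helper lemmas are stated for any prime `𝔮` with `t ∈ 𝔮 ↔ v_O(χ t) < 1`, any localization `L`
of `T` at `𝔮`, and any `χ' : L → K` extending `χ`; no new definitions are introduced.

References: EGA IV₄ 17.5.8 (iii); U. Görtz, T. Wedhorn, *Algebraic Geometry I*, 2nd ed. (2020),
Lemma 6.26.
-/

noncomputable section

-- single-problem summit: the doubled namespace component `ResolutionOfSingularities` is forced
set_option linter.dupNamespace false

open Literature.AlgebraicGeometry.Resolution (isRegularLocalRing_of_isSmoothAt)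
open IsLocalRing

namespace Summit.ResolutionOfSingularities.ResolutionOfSingularities.Theorems.IndSmoothBirth

section LocalChart

variable {k K : Type} [Field k] [Field K] [Algebra k K] (O : ValuationSubring K)
  {T : Type} [CommRing T] [Algebra k T] {χ : T →ₐ[k] K} {𝔮 : Ideal T}

/-- Off the centre `𝔮 = χ⁻¹(𝔪_O)` of a chart `χ : T → K` landing in `O`, the chart has valuation
exactly `1`. [folklore] -/
theorem localChart_valuation_eq_one (hχO : ∀ t : T, χ t ∈ O)
    (h𝔮 : ∀ t : T, t ∈ 𝔮 ↔ O.valuation (χ t) < 1) {t : T} (ht : t ∉ 𝔮) :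
    O.valuation (χ t) = 1 := by
  rw [h𝔮, not_lt] at ht
  exact le_antisymm ((O.valuation_le_one_iff _).mpr (hχO t)) ht

/-- Off the centre `𝔮 = χ⁻¹(𝔪_O)` of a chart `χ : T → K` landing in `O`, the chart takes unit
(i.e. non-zero) values in the field `K`. [folklore] -/
theorem localChart_isUnit (hχO : ∀ t : T, χ t ∈ O)
    (h𝔮 : ∀ t : T, t ∈ 𝔮 ↔ O.valuation (χ t) < 1) {t : T} (ht : t ∉ 𝔮) : IsUnit (χ t) := by
  refine isUnit_iff_ne_zero.mpr fun h => ?_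
  have h1 := localChart_valuation_eq_one O hχO h𝔮 ht
  rw [h, map_zero] at h1
  exact zero_ne_one h1

variable [𝔮.IsPrime] (L : Type) [CommRing L] [Algebra T L] [IsLocalization.AtPrime L 𝔮]
  [Algebra k L] {χ' : L →ₐ[k] K}

/-- An extension `χ'` of the chart to `T_𝔮`, on a fraction: `χ'(t/s) · χ(s) = χ(t)`. [folklore] -/
theorem localChart_lift_mk'_mul (hχ' : ∀ t : T, χ' (algebraMap T L t) = χ t) (t : T)
    (s : 𝔮.primeCompl) : χ' (IsLocalization.mk' L t s) * χ s = χ t := by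
  have h := congrArg χ' (IsLocalization.mk'_spec L t s)
  rwa [map_mul, hχ', hχ'] at h

/-- An extension `χ'` of the chart to `T_𝔮` preserves valuations of numerators:
`v_O(χ'(t/s)) = v_O(χ t)`, the denominator having valuation `1`. [folklore] -/
theorem localChart_valuation_lift_mk' (hχO : ∀ t : T, χ t ∈ O)
    (h𝔮 : ∀ t : T, t ∈ 𝔮 ↔ O.valuation (χ t) < 1) (hχ' : ∀ t : T, χ' (algebraMap T L t) = χ t)
    (t : T) (s : 𝔮.primeCompl) :
    O.valuation (χ' (IsLocalization.mk' L t s)) = O.valuation (χ t) := by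
  rw [← localChart_lift_mk'_mul L hχ' t s, map_mul, localChart_valuation_eq_one O hχO h𝔮 s.2,
    mul_one]

/-- An extension `χ'` of the chart to `T_𝔮` lands in `O`. [folklore] -/
theorem localChart_lift_mem (hχO : ∀ t : T, χ t ∈ O)
    (h𝔮 : ∀ t : T, t ∈ 𝔮 ↔ O.valuation (χ t) < 1) (hχ' : ∀ t : T, χ' (algebraMap T L t) = χ t)
    (x : L) : χ' x ∈ O := by
  obtain ⟨⟨t, s⟩, rfl⟩ := IsLocalization.mk'_surjective 𝔮.primeCompl x
  rw [← O.valuation_le_one_iff, localChart_valuation_lift_mk' O L hχO h𝔮 hχ']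
  exact (O.valuation_le_one_iff _).mpr (hχO t)

/-- An extension `χ'` of the chart to `T_𝔮` detects the maximal ideal: `χ'⁻¹(𝔪_O) = 𝔪_{T_𝔮}`.
[folklore] -/
theorem localChart_mem_maximalIdeal_iff [IsLocalRing L] (hχO : ∀ t : T, χ t ∈ O)
    (h𝔮 : ∀ t : T, t ∈ 𝔮 ↔ O.valuation (χ t) < 1) (hχ' : ∀ t : T, χ' (algebraMap T L t) = χ t)
    (x : L) : x ∈ maximalIdeal L ↔ O.valuation (χ' x) < 1 := by
  obtain ⟨⟨t, s⟩, rfl⟩ := IsLocalization.mk'_surjective 𝔮.primeCompl x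
  rw [IsLocalization.AtPrime.mk'_mem_maximal_iff L 𝔮 t s,
    localChart_valuation_lift_mk' O L hχO h𝔮 hχ', h𝔮]

end LocalChart

/-- **Registered stub `stub_localChart`: a smooth chart localizes to a local regular chart.**
Let `R ⊆ K` be a `k`-subalgebra of a field with valuation ring `O`, and `R → T → O` a smooth chart
(`T` smooth over `k`, `ψ : R → T`, `χ : T → K` with `χ(T) ⊆ O` and `χ ∘ ψ =` the inclusion).
Then there is a regular local `k`-algebra `L`, essentially of finite type, with `ψ' : R → L`,
`χ' : L → K`, `χ'(L) ⊆ O`, `χ'⁻¹(𝔪_O) = 𝔪_L` and `χ' ∘ ψ' =` the inclusion: take `L = T_𝔮` for the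
centre `𝔮 = χ⁻¹(𝔪_O)`; `T_𝔮` is regular since smooth over a field implies regular
(EGA IV 17.5.8 (iii)), `χ` extends because `T ∖ 𝔮` maps to units of `O`, and
`χ'⁻¹(𝔪_O) = 𝔮 T_𝔮`. [cite: GortzWedhorn2020, Lemma 6.26] -/
theorem stub_localChart (k K : Type) [Field k] [Field K] [Algebra k K] (O : ValuationSubring K)
    (R : Subalgebra k K) (T : Type) [CommRing T] [Algebra k T] [Algebra.Smooth k T]
    (ψ : R →ₐ[k] T) (χ : T →ₐ[k] K) (hχO : ∀ t : T, χ t ∈ O)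
    (hψχ : ∀ r : R, χ (ψ r) = (r : K)) :
    ∃ (L : Type) (_ : CommRing L) (_ : IsRegularLocalRing L) (_ : Algebra k L)
      (_ : Algebra.EssFiniteType k L) (ψ' : R →ₐ[k] L) (χ' : L →ₐ[k] K),
      (∀ x : L, χ' x ∈ O) ∧ (∀ x : L, x ∈ maximalIdeal L ↔ O.valuation (χ' x) < 1) ∧
        ∀ r : R, χ' (ψ' r) = (r : K) := by
  -- the centre `𝔮 = χ⁻¹(𝔪_O)`: the preimage of `𝔪_O` under the cod-restriction `T → O` of `χ`
  let χO : T →+* O := χ.toRingHom.codRestrict O hχO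
  let 𝔮 : Ideal T := Ideal.comap χO (maximalIdeal O)
  haveI : 𝔮.IsPrime := Ideal.comap_isPrime χO _
  have h𝔮 : ∀ t : T, t ∈ 𝔮 ↔ O.valuation (χ t) < 1 := fun t => by
    change χO t ∈ maximalIdeal O ↔ _
    rw [ValuationSubring.valuation_lt_one_iff]
    rfl
  -- `T` is smooth over the field `k`, in particular at `𝔮`, hence `T_𝔮` is regular
  haveI : Algebra.IsSmoothAt k 𝔮 := by
    have h : (⟨𝔮, inferInstance⟩ : PrimeSpectrum T) ∈ Algebra.smoothLocus k T := by
      rw [Algebra.smoothLocus_eq_univ]; trivial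
    exact h
  haveI : IsRegularLocalRing (Localization.AtPrime 𝔮) := isRegularLocalRing_of_isSmoothAt k T 𝔮
  -- `χ` extends to `T_𝔮`: the denominators are units of `K`
  let χ' : Localization.AtPrime 𝔮 →ₐ[k] K :=
    IsLocalization.liftAlgHom (M := 𝔮.primeCompl) (f := χ) fun s => localChart_isUnit O hχO h𝔮 s.2
  have hχ' : ∀ t : T, χ' (algebraMap T (Localization.AtPrime 𝔮) t) = χ t := fun t =>
    IsLocalization.lift_eq _ t
  refine ⟨Localization.AtPrime 𝔮, inferInstance, inferInstance, inferInstance, inferInstance,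
    (IsScalarTower.toAlgHom k T (Localization.AtPrime 𝔮)).comp ψ, χ',
    localChart_lift_mem O _ hχO h𝔮 hχ', localChart_mem_maximalIdeal_iff O _ hχO h𝔮 hχ',
    fun r => ?_⟩
  rw [AlgHom.comp_apply, IsScalarTower.coe_toAlgHom', hχ', hψχ]

end Summit.ResolutionOfSingularities.ResolutionOfSingularities.Theorems.IndSmoothBirth

end
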